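import Mathlib
import Literature.Analysis.FluidPDE.AxisymmetricReflection
import Summits.NavierStokesRegularity.NavierStokesRegularity.Theorems.ThreadingFluxHorizonTowerL2ZonalParity
import HarnessLib

/-!
# Crux `PoloidalLiouville` (stmt-NavierStokesRegularity-1222, wall W1), crux idea «horizon-threading-tower» (ns-idea-15):
# mirror-symmetric (axisymmetric swirl-free) fields are UNTHREADED and annihilated by BOTH horizon laws

Support file (Theorems-side tooling; seat ns-wall-eng-7 g4, cell ns-wall-extremal, W1 adjunct; `--supports
stmt-NavierStokesRegularity-1222 --as helper`).  Sequel of `ThreadingFluxHorizonTowerL2ZonalParity.lean` (p676078): the same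
reflection-parity bookkeeping gives, for a field `U` that is mirror-even (`U (S y) = S (U y)`) for the mirror `S` across a plane
through the origin, at every point `x` of that plane:

* `HorizonTower.inner_curl_self_eq_zero_of_mirror_even` — `⟪curl U x, x⟫ = 0` (the threading flux about the origin vanishes:
  `curl U` is mirror-odd);
* `HorizonTower.horizonL1_eq_zero_of_mirror_even` — `𝔏₁[U](x) = r⟪x, curl(U × curl U)⟫ = 0` (order-one horizon law);
* (order two is `horizonL2_eq_zero_of_mirror_even` of the parity file);

and, packaging over all planes containing an axis `a` — i.e. for fields that are AXISYMMETRIC WITHOUT SWIRL about `a` in the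
coordinate-free sense «mirror-even for every mirror fixing `a`» —

* ★ `HorizonTower.unthreaded_and_horizonLaws_eq_zero_of_mirror_even_family` — for every `x`: `⟪curl U x, x⟫ = 0`,
  `horizonL1 U 0 x = 0` and `horizonL2 U 0 x = 0`;
* `HorizonTower.threadingFlux_eq_zero_of_mirror_even_family` — the same for the time-dependent `threadingFlux u 0 t`.

and, through the tree's vocabulary for axisymmetric flows about the `x₂`-axis (`Literature.Analysis.FluidPDE.IsAxisymmetric`,
`HasNoSwirl`, `rotZ`, `reflY` of `AxisymmetricEuler.lean` / `AxisymmetricReflection.lean`; KNSS 2009 §1, Majda–Bertozzi §2.3.3):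

* `HorizonTower.exists_mirror_eq_rotZ_reflY_rotZ` — every meridian mirror `((ℝ ∙ n)ᗮ).reflection` (unit `n ⊥ e₂`) is the conjugate
  `R_β ∘ σ ∘ R_{−β}` of the Literature's meridian reflection `σ = reflY` by a rotation `R_β = rotZ β`;
* `HorizonTower.mirror_even_of_isAxisymmetric_hasNoSwirl` — an axisymmetric swirl-free field is mirror-even for EVERY meridian mirror
  (`IsAxisymmetric.reflY_eq_of_hasNoSwirl` + rotation equivariance);
* ★ `HorizonTower.unthreaded_and_horizonLaws_eq_zero_of_isAxisymmetric_hasNoSwirl`,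
  `HorizonTower.threadingFlux_eq_zero_of_isAxisymmetric_hasNoSwirl` — for `u` axisymmetric without swirl (Literature sense) and
  every `x`: `⟪curl u x, x⟫ = 0`, `horizonL1 u 0 x = 0`, `horizonL2 u 0 x = 0`, `threadingFlux u 0 t x = 0`.

This is the kernel form of the Defs-file remark «axisymmetric-no-swirl far fields never thread» and of the NON-VACUITY clause of the
rungs (`BoundedEndpointShellRungDatum` docstring: axisymmetric swirl-free evolutions are unthreaded about every axis point) at the level
of a single slice about the origin; no smoothness is needed (the junk value `0` of `curl` is parity-consistent).

HONEST LABEL: symmetry lemmas about typed objects of one crux idea; `HorizonZonalitySingleDegree` (l ≥ 4), `HorizonTowerZonality`,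
`PoloidalLiouville` (1222), `UnthreadedRigidity` (27585) and NS regularity remain OPEN and untouched; information-grade for W1/W2
(movement 0).  [cite: ArfkenWeber1995, §2.9 eq. (2.90), (2.97)–(2.99)] [cite: MajdaBertozziCUP2002, §2.3.3 (2.52)–(2.53)]
[cite: KNSS2009, §1 (1.5)]
-/

-- the summit and its single problem share the name (D-0017 nested layout)
set_option linter.dupNamespace false

noncomputable section

open scoped RealInnerProductSpace
open Literature.Analysis.FluidPDE

namespace Summit.NavierStokesRegularity.NavierStokesRegularity.Theorems.PoloidalLiouville.HorizonTower

section Mirror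

variable {n : E3}

/-- **Mirror-even fields are unthreaded on the mirror plane**: if `U (S y) = S (U y)` for all `y` and `S x = x`, then
`⟪curl U x, x⟫ = 0` (`curl U` is mirror-odd, and an odd field is orthogonal to the fixed vector `x`). -/
theorem inner_curl_self_eq_zero_of_mirror_even (hn : ‖n‖ = 1) {U : E3 → E3}
    (hU : ∀ y, U ((ℝ ∙ n)ᗮ.reflection y) = (ℝ ∙ n)ᗮ.reflection (U y)) {x : E3}
    (hx : (ℝ ∙ n)ᗮ.reflection x = x) : ⟪curl U x, x⟫ = 0 := by
  have hΩ := curl_mirror_of_even hn (V := U) hU x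
  rw [hx] at hΩ
  have hodd : (ℝ ∙ n)ᗮ.reflection (curl U x) = -curl U x := by
    have h := congrArg ((ℝ ∙ n)ᗮ.reflection) hΩ
    rw [map_neg, Submodule.reflection_reflection] at h
    exact h
  rw [real_inner_comm]
  exact inner_eq_zero_of_mirror_odd_at hx hodd

/-- **`𝔏₁` vanishes on the mirror plane for mirror-even fields**: if `U (S y) = S (U y)` for all `y` and `S x = x`, then
`horizonL1 U 0 x = 0` — `U × curl U` is even (even × odd), so its curl is odd. -/
theorem horizonL1_eq_zero_of_mirror_even (hn : ‖n‖ = 1) {U : E3 → E3}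
    (hU : ∀ y, U ((ℝ ∙ n)ᗮ.reflection y) = (ℝ ∙ n)ᗮ.reflection (U y)) {x : E3}
    (hx : (ℝ ∙ n)ᗮ.reflection x = x) : horizonL1 U 0 x = 0 := by
  -- `Ω = curl U` is odd, `A = U × Ω` is even, `curl A` is odd
  have hΩ : ∀ y, curl U ((ℝ ∙ n)ᗮ.reflection y) = -(ℝ ∙ n)ᗮ.reflection (curl U y) :=
    curl_mirror_of_even hn (V := U) hU
  have hA : ∀ y, cross (U ((ℝ ∙ n)ᗮ.reflection y)) (curl U ((ℝ ∙ n)ᗮ.reflection y))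
      = (ℝ ∙ n)ᗮ.reflection (cross (U y) (curl U y)) :=
    fun y => cross_mirror_even_odd hn (V := U) (W := curl U) hU hΩ y
  have hC := curl_mirror_of_even hn (V := fun z => cross (U z) (curl U z)) hA x
  rw [hx] at hC
  have hodd : (ℝ ∙ n)ᗮ.reflection (curl (fun z => cross (U z) (curl U z)) x)
      = -curl (fun z => cross (U z) (curl U z)) x := by
    have h := congrArg ((ℝ ∙ n)ᗮ.reflection) hC
    rw [map_neg, Submodule.reflection_reflection] at h
    exact h
  unfold horizonL1
  rw [sub_zero, inner_eq_zero_of_mirror_odd_at hx hodd, mul_zero]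

end Mirror

/-! ### Fields mirror-even for every plane containing an axis (axisymmetric without swirl) -/

/-- ★ **Axisymmetric swirl-free fields are unthreaded and annihilated by both horizon laws.**  If `U` is mirror-even for EVERY mirror
fixing the axis `a` (every unit normal `n ⊥ a`) — the coordinate-free form of «axisymmetric without swirl about `a`» — then at every
point `x`: the threading flux `⟪curl U x, x⟫`, the order-one law `horizonL1 U 0 x` and the order-two law `horizonL2 U 0 x` all vanish
(choose the mirror through `a` and `x`).  No smoothness hypothesis. -/
theorem unthreaded_and_horizonLaws_eq_zero_of_mirror_even_family {a : E3} {U : E3 → E3}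
    (hU : ∀ n : E3, ‖n‖ = 1 → ⟪n, a⟫ = 0 → ∀ y, U ((ℝ ∙ n)ᗮ.reflection y) = (ℝ ∙ n)ᗮ.reflection (U y))
    (x : E3) : ⟪curl U x, x⟫ = 0 ∧ horizonL1 U 0 x = 0 ∧ horizonL2 U 0 x = 0 := by
  obtain ⟨n, hn, hna, hnx⟩ := exists_unit_orthogonal_pair a x
  have hSx : (ℝ ∙ n)ᗮ.reflection x = x := mirror_apply_of_inner_eq_zero hn hnx
  exact ⟨inner_curl_self_eq_zero_of_mirror_even hn (hU n hn hna) hSx,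
    horizonL1_eq_zero_of_mirror_even hn (hU n hn hna) hSx,
    horizonL2_eq_zero_of_mirror_even hn (hU n hn hna) hSx⟩

/-- **The threading flux of a mirror-symmetric evolution vanishes about the origin**: if at time `t` the slice `u t` is mirror-even for
every mirror fixing the axis `a`, then `threadingFlux u 0 t x = 0` for every `x`. -/
theorem threadingFlux_eq_zero_of_mirror_even_family {a : E3} {u : ℝ → E3 → E3} {t : ℝ}
    (hU : ∀ n : E3, ‖n‖ = 1 → ⟪n, a⟫ = 0 → ∀ y, u t ((ℝ ∙ n)ᗮ.reflection y) = (ℝ ∙ n)ᗮ.reflection (u t y))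
    (x : E3) : threadingFlux u 0 t x = 0 := by
  unfold threadingFlux
  rw [sub_zero]
  exact (unthreaded_and_horizonLaws_eq_zero_of_mirror_even_family hU x).1

/-! ### Bridge to the Literature's axisymmetric swirl-free class (`IsAxisymmetric`, `HasNoSwirl`; axis `e₂`) -/

/-- **Meridian mirrors are conjugates of `σ = reflY` by rotations about the axis**: for a unit `n` with `n₂ = 0` there is an angle `β`
(`cos β = n₁`, `sin β = −n₀`) with `S_n = R_β ∘ σ ∘ R_{−β}`. -/
theorem exists_mirror_eq_rotZ_reflY_rotZ {n : E3} (hn : ‖n‖ = 1) (hn2 : n 2 = 0) :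
    ∃ β : ℝ, ∀ x : E3, (ℝ ∙ n)ᗮ.reflection x = rotZ β (reflY (rotZ (-β) x)) := by
  have hn' : n 1 ^ 2 + (-(n 0)) ^ 2 = 1 := by
    have h := EuclideanSpace.real_norm_sq_eq n
    rw [hn, Fin.sum_univ_three, hn2] at h
    linarith
  obtain ⟨β, hc, hs⟩ := exists_cos_eq_sin_eq hn'
  refine ⟨β, fun x => ?_⟩
  ext i
  fin_cases i
  · simp only [Fin.zero_eta, Fin.isValue, mirror_apply_coord hn, hn2, rotZ_apply_zero, reflY_apply_zero,
      reflY_apply_one, rotZ_apply_one, Real.cos_neg, Real.sin_neg, hc, hs]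
    linear_combination (-(x 0)) * hn'
  · simp only [Fin.mk_one, Fin.isValue, mirror_apply_coord hn, hn2, rotZ_apply_one, reflY_apply_zero,
      reflY_apply_one, rotZ_apply_zero, Real.cos_neg, Real.sin_neg, hc, hs]
    linear_combination (-(x 1)) * hn'
  · simp only [Fin.reduceFinMk, Fin.isValue, mirror_apply_coord hn, hn2, rotZ_apply_two, reflY_apply_two]
    ring

/-- **An axisymmetric swirl-free field is mirror-even for every meridian mirror** (unit `n ⊥ e₂`):
`u (S_n y) = S_n (u y)` — `S_n = R_β σ R_{−β}`, and `u` commutes with `R_{±β}` (`IsAxisymmetric`) and with `σ`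
(`IsAxisymmetric.reflY_eq_of_hasNoSwirl`). -/
theorem mirror_even_of_isAxisymmetric_hasNoSwirl {u : E3 → E3} (hu : IsAxisymmetric u) (hsw : HasNoSwirl u)
    {n : E3} (hn : ‖n‖ = 1) (hn2 : ⟪n, EuclideanSpace.single (2 : Fin 3) (1 : ℝ)⟫ = 0) (y : E3) :
    u ((ℝ ∙ n)ᗮ.reflection y) = (ℝ ∙ n)ᗮ.reflection (u y) := by
  have hn2' : n 2 = 0 := by
    rw [EuclideanSpace.inner_single_right] at hn2
    simpa using hn2
  obtain ⟨β, hβ⟩ := exists_mirror_eq_rotZ_reflY_rotZ hn hn2'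
  rw [hβ, hβ, hu β, hu.reflY_eq_of_hasNoSwirl hsw, hu (-β)]

/-- ★ **Axisymmetric swirl-free fields (the Literature's class, axis `e₂`) are unthreaded about the origin and annihilated by both
horizon laws**: for every `x`, `⟪curl u x, x⟫ = 0`, `horizonL1 u 0 x = 0`, `horizonL2 u 0 x = 0`.  No smoothness hypothesis. -/
theorem unthreaded_and_horizonLaws_eq_zero_of_isAxisymmetric_hasNoSwirl {u : E3 → E3}
    (hu : IsAxisymmetric u) (hsw : HasNoSwirl u) (x : E3) :
    ⟪curl u x, x⟫ = 0 ∧ horizonL1 u 0 x = 0 ∧ horizonL2 u 0 x = 0 :=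
  unthreaded_and_horizonLaws_eq_zero_of_mirror_even_family (a := EuclideanSpace.single (2 : Fin 3) (1 : ℝ))
    (fun _ hn hna y => mirror_even_of_isAxisymmetric_hasNoSwirl hu hsw hn hna y) x

/-- **The threading flux about the origin of an axisymmetric swirl-free slice vanishes**: if `u t` is axisymmetric without swirl
then `threadingFlux u 0 t x = 0` for every `x` (witness class of the rungs' NON-VACUITY clause, one slice, kernel form). -/
theorem threadingFlux_eq_zero_of_isAxisymmetric_hasNoSwirl {u : ℝ → E3 → E3} {t : ℝ}
    (hu : IsAxisymmetric (u t)) (hsw : HasNoSwirl (u t)) (x : E3) : threadingFlux u 0 t x = 0 :=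
  threadingFlux_eq_zero_of_mirror_even_family (a := EuclideanSpace.single (2 : Fin 3) (1 : ℝ))
    (fun _ hn hna y => mirror_even_of_isAxisymmetric_hasNoSwirl hu hsw hn hna y) x

end Summit.NavierStokesRegularity.NavierStokesRegularity.Theorems.PoloidalLiouville.HorizonTower

end
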